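import Summits.RiemannHypothesis.RiemannHypothesis.Theorems.PfPersistenceEdgeLawCutKernel

/-!
# Edge law by cutting — the layer-cake bound for the far weight (RH-free)

Part of the pub-rhpf THEORY-2 programme (mechanism / rigidity of the Weil window bottom; no RH
claims). The far (singular) zone of the sharp commutator estimate of a steep cut needs the weighted
mass `∫_{R ≤ a−|x| ≤ r₀} ‖u x‖² g(a − |x|)`, `g(s) = √(log 1/s)/(2s)` (`cutFarWeight`), bounded in
terms of the CUMULATIVE edge masses `m(r) = ∫_{a−r<|x|} ‖u‖² ≤ I′ r/log(1/r)` only. Dyadic shells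
lose a constant factor; the sharp bound is the layer-cake (Abel summation) identity
`∫ ‖u‖² g(dep) = g(r₀) ∫ ‖u‖² + ∫_R^{r₀} (−g′)(σ) m_D(σ) dσ`, proved here by Tonelli in `ℝ≥0∞`:

* `lintegral_cutFarWeight_le`:
  `∫⁻_{R ≤ a−|x| ≤ r₀} ‖u‖² g(a−|x|) ≤ g(r₀) ∫‖u‖² + I′((√L_R − √L_{r₀}) + (1/(2√L_{r₀}) − 1/(2√L_R)))`,
  `L_s = log(1/s)`;
* `setIntegral_cutFarWeight_le`: the same for the Bochner integral.

Sources: E. Bombieri, *Remarks on Weil's quadratic functional in the theory of prime numbers I*,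
Rend. Mat. Acc. Lincei (9) 11 (2000) §4; G. H. Hardy, J. E. Littlewood, G. Pólya, *Inequalities*
(1934) Ch. X (rearrangement / layer-cake).
-/

set_option linter.dupNamespace false

noncomputable section

open MeasureTheory Set Filter
open scoped Topology ENNReal NNReal

namespace Summit.RiemannHypothesis.RiemannHypothesis.Theorems.PfPersistence

open Literature.NumberTheory.LFunctions
open Summit.RiemannHypothesis.RiemannHypothesis.Theorems.WeilWindowFlowWindowLipschitz

/-- **Layer-cake (Abel) bound for the far weight.** If `u` is measurable with `‖u‖²` integrable and
the cumulative edge masses obey `∫_{a−r<|x|} ‖u‖² ≤ I′ r/log(1/r)` for `0 < r ≤ r₀` (`r₀ < 1`,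
`I′ ≥ 0`), then for `0 < R ≤ r₀`, in `ℝ≥0∞`,
`∫⁻_{R ≤ a−|x| ≤ r₀} ‖u x‖² g(a − |x|) ≤ g(r₀) ∫‖u‖² + I′((√L_R − √L_{r₀}) + (1/(2√L_{r₀}) − 1/(2√L_R)))`
(`g = cutFarWeight`, `L_s = log(1/s)`): write `g(s) = g(r₀) + ∫_s^{r₀} k`, exchange the integrals
(Tonelli), bound the inner mass `∫_{a−σ<|x|} ‖u‖²` by `I′σ/L_σ`, and integrate `k(σ)σ/L_σ` in closed
form. [folklore] -/
theorem lintegral_cutFarWeight_le {u : ℝ → ℂ} {a R r₀ I' : ℝ} (hum : Measurable u)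
    (hu2 : Integrable fun x ↦ ‖u x‖ ^ 2) (hR : 0 < R) (hRr : R ≤ r₀) (hr1 : r₀ < 1) (hI : 0 ≤ I')
    (hB : ∀ r, 0 < r → r ≤ r₀ →
      ∫ x in {x : ℝ | a - r < |x|}, ‖u x‖ ^ 2 ≤ I' * r / Real.log (1 / r)) :
    ∫⁻ x in {x : ℝ | R ≤ a - |x| ∧ a - |x| ≤ r₀}, ENNReal.ofReal (‖u x‖ ^ 2 * cutFarWeight (a - |x|))
      ≤ ENNReal.ofReal (cutFarWeight r₀ * (∫ x, ‖u x‖ ^ 2) +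
        I' * ((Real.sqrt (Real.log (1 / R)) - Real.sqrt (Real.log (1 / r₀))) +
          (1 / (2 * Real.sqrt (Real.log (1 / r₀))) - 1 / (2 * Real.sqrt (Real.log (1 / R)))))) := by
  set D : Set ℝ := {x | R ≤ a - |x| ∧ a - |x| ≤ r₀} with hD
  have hdepm : Measurable fun x : ℝ ↦ a - |x| := measurable_const.sub continuous_abs.measurable
  have hDm : MeasurableSet D :=
    (measurableSet_le measurable_const hdepm).inter (measurableSet_le hdepm measurable_const)
  have hDpos : ∀ x ∈ D, 0 < a - |x| ∧ a - |x| < 1 := fun x hx ↦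
    ⟨hR.trans_le hx.1, hx.2.trans_lt hr1⟩
  -- the inner integral `Φ(x) = ∫_{a-|x|}^{r₀} k`
  set Φ : ℝ → ℝ := fun x ↦ ∫ σ in (a - |x|)..r₀, cutFarWeightDeriv σ with hΦ
  have hΦ0 : ∀ x ∈ D, 0 ≤ Φ x := fun x hx ↦
    intervalIntegral.integral_nonneg hx.2 fun σ hσ ↦
      cutFarWeightDeriv_nonneg ((hDpos x hx).1.trans_le hσ.1)
  have hgsplit : ∀ x ∈ D, cutFarWeight (a - |x|) = cutFarWeight r₀ + Φ x := fun x hx ↦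
    cutFarWeight_eq_add_integral (hDpos x hx).1 hx.2 hr1
  -- closed form of the `σ`-integral
  obtain ⟨hKi, hKval⟩ := integral_cutFarWeightDeriv_mul hR hRr hr1
  set Cfar : ℝ := (Real.sqrt (Real.log (1 / R)) - Real.sqrt (Real.log (1 / r₀))) +
      (1 / (2 * Real.sqrt (Real.log (1 / r₀))) - 1 / (2 * Real.sqrt (Real.log (1 / R))))
    with hCfar
  have hCfar0 : 0 ≤ Cfar := by
    rw [← hKval]
    exact intervalIntegral.integral_nonneg hRr fun σ hσ ↦
      cutFarWeightDeriv_mul_nonneg (hR.trans_le hσ.1) (hσ.2.trans_lt hr1)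
  have hw0 : ∀ x, 0 ≤ ‖u x‖ ^ 2 := fun x ↦ by positivity
  have hwm : Measurable fun x ↦ ‖u x‖ ^ 2 := hum.norm.pow_const 2
  have hkm : Measurable cutFarWeightDeriv := by
    unfold cutFarWeightDeriv
    fun_prop
  have hg0 : 0 ≤ cutFarWeight r₀ := cutFarWeight_nonneg (hR.trans_le hRr)
  -- the joint integrand of the Tonelli step
  set F : ℝ → ℝ → ℝ≥0∞ := fun x σ ↦ D.indicator (fun x ↦ ENNReal.ofReal (‖u x‖ ^ 2)) x *
      ((Ioc R r₀).indicator (fun σ ↦ ENNReal.ofReal (cutFarWeightDeriv σ)) σ *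
        {p : ℝ × ℝ | a - |p.1| < p.2}.indicator 1 (x, σ)) with hF
  have hSm : MeasurableSet {p : ℝ × ℝ | a - |p.1| < p.2} :=
    measurableSet_lt (hdepm.comp measurable_fst) measurable_snd
  have hFm : Measurable (Function.uncurry F) := by
    refine Measurable.mul ((hwm.ennreal_ofReal.indicator hDm).comp measurable_fst)
      (Measurable.mul ((hkm.ennreal_ofReal.indicator measurableSet_Ioc).comp measurable_snd) ?_)
    exact (measurable_one.indicator hSm)
  -- inner identification: `∫⁻ σ, F x σ = 1_D(x) ofReal(‖u x‖²) ofReal(Φ x)`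
  have hinner : ∀ x ∈ D, ∫⁻ σ, F x σ = ENNReal.ofReal (‖u x‖ ^ 2) * ENNReal.ofReal (Φ x) := by
    intro x hx
    have hxr : a - |x| ≤ r₀ := hx.2
    have heq : ∀ σ, F x σ = ENNReal.ofReal (‖u x‖ ^ 2) *
        (Ioc (a - |x|) r₀).indicator (fun σ ↦ ENNReal.ofReal (cutFarWeightDeriv σ)) σ := by
      intro σ
      simp only [hF]
      rw [indicator_of_mem hx]
      congr 1
      by_cases h1 : σ ∈ Ioc (a - |x|) r₀
      · have h2 : σ ∈ Ioc R r₀ := ⟨lt_of_le_of_lt hx.1 h1.1, h1.2⟩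
        have h3 : (x, σ) ∈ {p : ℝ × ℝ | a - |p.1| < p.2} := h1.1
        rw [indicator_of_mem h1, indicator_of_mem h2, indicator_of_mem h3, Pi.one_apply, mul_one]
      · rw [indicator_of_notMem h1]
        by_cases h3 : (x, σ) ∈ {p : ℝ × ℝ | a - |p.1| < p.2}
        · have h4 : σ ∉ Ioc R r₀ := fun h ↦ h1 ⟨h3, h.2⟩
          rw [indicator_of_notMem h4, zero_mul]
        · rw [indicator_of_notMem h3, mul_zero]
    have hFx : F x = fun σ ↦ ENNReal.ofReal (‖u x‖ ^ 2) *
        (Ioc (a - |x|) r₀).indicator (fun σ ↦ ENNReal.ofReal (cutFarWeightDeriv σ)) σ := funext heq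
    rw [hFx, lintegral_const_mul' _ _ ENNReal.ofReal_ne_top, lintegral_indicator measurableSet_Ioc,
      hΦ]
    congr 1
    simp only []
    rw [intervalIntegral.integral_of_le hxr, ofReal_integral_eq_lintegral_ofReal]
    · exact ((continuousOn_cutFarWeightDeriv (hDpos x hx).1 hr1).integrableOn_compact
        isCompact_Icc).mono_set Ioc_subset_Icc_self
    · exact (ae_restrict_iff' measurableSet_Ioc).2 (Eventually.of_forall fun σ hσ ↦
        cutFarWeightDeriv_nonneg ((hDpos x hx).1.trans hσ.1))
  have hinner0 : ∀ x ∉ D, ∫⁻ σ, F x σ = 0 := by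
    intro x hx
    have hzero : ∀ σ, F x σ = 0 := fun σ ↦ by
      simp only [hF]
      rw [indicator_of_notMem hx, zero_mul]
    simp_rw [hzero]
    exact lintegral_zero
  -- outer bound: `∫⁻ x, F x σ ≤ 1_{Ioc R r₀}(σ) k(σ) (I′σ/L_σ)`
  have houter : ∀ σ, ∫⁻ x, F x σ ≤ (Ioc R r₀).indicator
      (fun σ ↦ ENNReal.ofReal (cutFarWeightDeriv σ * (I' * σ / Real.log (1 / σ)))) σ := by
    intro σ
    by_cases hσ : σ ∈ Ioc R r₀
    · have hσ0 : 0 < σ := hR.trans hσ.1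
      have hpt : ∀ x, F x σ ≤ ENNReal.ofReal (cutFarWeightDeriv σ) *
          {x : ℝ | a - σ < |x|}.indicator (fun x ↦ ENNReal.ofReal (‖u x‖ ^ 2)) x := by
        intro x
        simp only [hF]
        by_cases hx : x ∈ D
        · by_cases h3 : (x, σ) ∈ {p : ℝ × ℝ | a - |p.1| < p.2}
          · have h4 : x ∈ {x : ℝ | a - σ < |x|} := by
              have : a - |x| < σ := h3
              show a - σ < |x|
              linarith
            rw [indicator_of_mem hx, indicator_of_mem hσ, indicator_of_mem h3, indicator_of_mem h4,
              Pi.one_apply, mul_one, mul_comm]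
          · rw [indicator_of_notMem h3, mul_zero, mul_zero]
            exact zero_le
        · rw [indicator_of_notMem hx, zero_mul]
          exact zero_le
      calc ∫⁻ x, F x σ ≤ ∫⁻ x, ENNReal.ofReal (cutFarWeightDeriv σ) *
            {x : ℝ | a - σ < |x|}.indicator (fun x ↦ ENNReal.ofReal (‖u x‖ ^ 2)) x :=
            lintegral_mono hpt
        _ = ENNReal.ofReal (cutFarWeightDeriv σ) *
            ∫⁻ x in {x : ℝ | a - σ < |x|}, ENNReal.ofReal (‖u x‖ ^ 2) := by
            rw [lintegral_const_mul' _ _ ENNReal.ofReal_ne_top,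
              lintegral_indicator (stub_commutatorBound_measurableSet_layer a σ)]
        _ = ENNReal.ofReal (cutFarWeightDeriv σ) *
            ENNReal.ofReal (∫ x in {x : ℝ | a - σ < |x|}, ‖u x‖ ^ 2) := by
            rw [ofReal_integral_eq_lintegral_ofReal hu2.integrableOn
              (Eventually.of_forall fun x ↦ hw0 x)]
        _ ≤ ENNReal.ofReal (cutFarWeightDeriv σ) * ENNReal.ofReal (I' * σ / Real.log (1 / σ)) := by
            gcongr
            exact hB σ hσ0 hσ.2
        _ = _ := by
            rw [indicator_of_mem hσ, ENNReal.ofReal_mul (cutFarWeightDeriv_nonneg hσ0)]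
    · have hzero : ∀ x, F x σ = 0 := fun x ↦ by
        simp only [hF]
        rw [indicator_of_notMem hσ, zero_mul, mul_zero]
      simp_rw [hzero]
      rw [lintegral_zero, indicator_of_notMem hσ]
  have hswap : ∫⁻ x, ∫⁻ σ, F x σ = ∫⁻ σ, ∫⁻ x, F x σ :=
    lintegral_lintegral_swap hFm.aemeasurable
  -- Step A: the Tonelli bound `∫⁻_D ‖u‖² Φ ≤ I′ Cfar`
  have hA : ∫⁻ x in D, ENNReal.ofReal (‖u x‖ ^ 2 * Φ x) ≤ ENNReal.ofReal (I' * Cfar) := by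
    have e1 : ∫⁻ x in D, ENNReal.ofReal (‖u x‖ ^ 2 * Φ x) = ∫⁻ x, ∫⁻ σ, F x σ := by
      rw [← lintegral_indicator hDm]
      refine lintegral_congr fun x ↦ ?_
      by_cases hx : x ∈ D
      · rw [indicator_of_mem hx, hinner x hx, ENNReal.ofReal_mul (hw0 x)]
      · rw [indicator_of_notMem hx, hinner0 x hx]
    rw [e1, hswap]
    calc ∫⁻ σ, ∫⁻ x, F x σ ≤ ∫⁻ σ, (Ioc R r₀).indicator
          (fun σ ↦ ENNReal.ofReal (cutFarWeightDeriv σ * (I' * σ / Real.log (1 / σ)))) σ :=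
          lintegral_mono houter
      _ = ∫⁻ σ in Ioc R r₀, ENNReal.ofReal (cutFarWeightDeriv σ * (I' * σ / Real.log (1 / σ))) :=
          lintegral_indicator measurableSet_Ioc _
      _ = ENNReal.ofReal (∫ σ in Ioc R r₀, cutFarWeightDeriv σ * (I' * σ / Real.log (1 / σ))) := by
          rw [ofReal_integral_eq_lintegral_ofReal]
          · have hi := (hKi.const_mul I')
            rw [intervalIntegrable_iff_integrableOn_Ioc_of_le hRr] at hi
            refine hi.congr (Eventually.of_forall fun σ ↦ ?_)
            simp only []
            ring
          · exact (ae_restrict_iff' measurableSet_Ioc).2 (Eventually.of_forall fun σ hσ ↦ by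
              have hσ0 : 0 < σ := hR.trans hσ.1
              have h := cutFarWeightDeriv_mul_nonneg hσ0 (hσ.2.trans_lt hr1)
              calc (0 : ℝ) ≤ I' * (cutFarWeightDeriv σ * (σ / Real.log (1 / σ))) := mul_nonneg hI h
                _ = _ := by ring)
      _ = ENNReal.ofReal (I' * Cfar) := by
          congr 1
          rw [← intervalIntegral.integral_of_le hRr, ← hKval, ← intervalIntegral.integral_const_mul]
          refine intervalIntegral.integral_congr fun σ _ ↦ ?_
          show _ = I' * _
          ring
  -- Step B: add the constant part `g(r₀) ‖u‖²`
  have hsplit : ∀ x ∈ D, ENNReal.ofReal (‖u x‖ ^ 2 * cutFarWeight (a - |x|)) =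
      ENNReal.ofReal (‖u x‖ ^ 2 * cutFarWeight r₀) + ENNReal.ofReal (‖u x‖ ^ 2 * Φ x) := by
    intro x hx
    rw [hgsplit x hx, mul_add, ENNReal.ofReal_add (mul_nonneg (hw0 x) hg0)
      (mul_nonneg (hw0 x) (hΦ0 x hx))]
  calc ∫⁻ x in D, ENNReal.ofReal (‖u x‖ ^ 2 * cutFarWeight (a - |x|))
      = ∫⁻ x in D, (ENNReal.ofReal (‖u x‖ ^ 2 * cutFarWeight r₀) +
          ENNReal.ofReal (‖u x‖ ^ 2 * Φ x)) :=
        setLIntegral_congr_fun hDm hsplit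
    _ = (∫⁻ x in D, ENNReal.ofReal (‖u x‖ ^ 2 * cutFarWeight r₀)) +
          ∫⁻ x in D, ENNReal.ofReal (‖u x‖ ^ 2 * Φ x) :=
        lintegral_add_left ((hwm.mul_const _).ennreal_ofReal) _
    _ ≤ ENNReal.ofReal (cutFarWeight r₀ * ∫ x, ‖u x‖ ^ 2) + ENNReal.ofReal (I' * Cfar) := by
        gcongr
        · calc ∫⁻ x in D, ENNReal.ofReal (‖u x‖ ^ 2 * cutFarWeight r₀)
              ≤ ∫⁻ x, ENNReal.ofReal (‖u x‖ ^ 2 * cutFarWeight r₀) := setLIntegral_le_lintegral _ _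
            _ = ENNReal.ofReal (∫ x, ‖u x‖ ^ 2 * cutFarWeight r₀) := by
                rw [ofReal_integral_eq_lintegral_ofReal (hu2.mul_const _)
                  (Eventually.of_forall fun x ↦ mul_nonneg (hw0 x) hg0)]
            _ = ENNReal.ofReal (cutFarWeight r₀ * ∫ x, ‖u x‖ ^ 2) := by
                rw [integral_mul_const, mul_comm]
    _ = _ := by
        rw [← ENNReal.ofReal_add (mul_nonneg hg0 (integral_nonneg hw0)) (mul_nonneg hI hCfar0)]

/-- Real-valued form of `lintegral_cutFarWeight_le`: the same bound for the Bochner integral (which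
vanishes if the integrand is not integrable). [folklore] -/
theorem setIntegral_cutFarWeight_le {u : ℝ → ℂ} {a R r₀ I' : ℝ} (hum : Measurable u)
    (hu2 : Integrable fun x ↦ ‖u x‖ ^ 2) (hR : 0 < R) (hRr : R ≤ r₀) (hr1 : r₀ < 1) (hI : 0 ≤ I')
    (hB : ∀ r, 0 < r → r ≤ r₀ →
      ∫ x in {x : ℝ | a - r < |x|}, ‖u x‖ ^ 2 ≤ I' * r / Real.log (1 / r)) :
    ∫ x in {x : ℝ | R ≤ a - |x| ∧ a - |x| ≤ r₀}, ‖u x‖ ^ 2 * cutFarWeight (a - |x|) ≤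
      cutFarWeight r₀ * (∫ x, ‖u x‖ ^ 2) +
        I' * ((Real.sqrt (Real.log (1 / R)) - Real.sqrt (Real.log (1 / r₀))) +
          (1 / (2 * Real.sqrt (Real.log (1 / r₀))) - 1 / (2 * Real.sqrt (Real.log (1 / R))))) := by
  have h := lintegral_cutFarWeight_le hum hu2 hR hRr hr1 hI hB
  have hdepm : Measurable fun x : ℝ ↦ a - |x| := measurable_const.sub continuous_abs.measurable
  have hDm : MeasurableSet {x : ℝ | R ≤ a - |x| ∧ a - |x| ≤ r₀} :=
    (measurableSet_le measurable_const hdepm).inter (measurableSet_le hdepm measurable_const)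
  have hw0 : ∀ x, 0 ≤ ‖u x‖ ^ 2 := fun x ↦ by positivity
  have hC0 : 0 ≤ cutFarWeight r₀ * (∫ x, ‖u x‖ ^ 2) +
      I' * ((Real.sqrt (Real.log (1 / R)) - Real.sqrt (Real.log (1 / r₀))) +
        (1 / (2 * Real.sqrt (Real.log (1 / r₀))) - 1 / (2 * Real.sqrt (Real.log (1 / R))))) := by
    obtain ⟨_, hKval⟩ := integral_cutFarWeightDeriv_mul hR hRr hr1
    rw [← hKval]
    exact add_nonneg (mul_nonneg (cutFarWeight_nonneg (hR.trans_le hRr)) (integral_nonneg hw0))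
      (mul_nonneg hI (intervalIntegral.integral_nonneg hRr fun σ hσ ↦
        cutFarWeightDeriv_mul_nonneg (hR.trans_le hσ.1) (hσ.2.trans_lt hr1)))
  have hnn : 0 ≤ᵐ[volume.restrict {x : ℝ | R ≤ a - |x| ∧ a - |x| ≤ r₀}]
      fun x ↦ ‖u x‖ ^ 2 * cutFarWeight (a - |x|) :=
    (ae_restrict_iff' hDm).2 (Eventually.of_forall fun x hx ↦
      mul_nonneg (hw0 x) (cutFarWeight_nonneg (hR.trans_le hx.1)))
  by_cases hint : Integrable (fun x ↦ ‖u x‖ ^ 2 * cutFarWeight (a - |x|))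
      (volume.restrict {x : ℝ | R ≤ a - |x| ∧ a - |x| ≤ r₀})
  · rw [integral_eq_lintegral_of_nonneg_ae hnn hint.aestronglyMeasurable]
    exact ENNReal.toReal_le_of_le_ofReal hC0 h
  · rw [integral_undef hint]
    exact hC0

end Summit.RiemannHypothesis.RiemannHypothesis.Theorems.PfPersistence

end
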